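import Literature.Probability.LatticeModels.PinningDomainStopping
import Literature.Probability.LatticeModels.IsingFiniteEnergy
import Literature.Probability.LatticeModels.OrientationTail
import HarnessLib

/-!
# The pinning domain: measurability and the strong-Markov hypothesis (GH2000, Lemma 5.2)

Topic `Probability/LatticeModels`. Measure-theoretic companions of `PinningDomain.lean` /
`PinningDomainStopping.lean`:

* `measurable_pinU`, `measurableSet_mem_pinJ`, `…_pinReach`, `…_pinCrust`, `…_pinDom`,
  `measurableSet_pinDom_eq` — the exploration domain is a measurable random finite set;
* `measurableSet_cylinderEvents_compl_of_invariant` — an event which is measurable and invariant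
  under re-patching the spins in a finite `G` belongs to `𝓕_{Gᶜ}`; hence
  **`measurableSet_cylinderEvents_pinDom_eq`**: `{pinDom = G} ∈ 𝓕_{Gᶜ}` (the hypothesis of the
  strong Markov property `measure_inter_strongMarkov`), from `pinDom_eq_of_agree`;
* **`ae_starCluster_unique_halfPlane_diff_box`** — almost surely the infinite `+∗`cluster of
  `S⁺ ∩ (π_up ∖ Λ_m)` is unique: uniqueness of the infinite `+∗`cluster of the half-plane
  (`ae_starCluster_unique_halfPlane`) for the configuration with `Λ_m` set to `-1`, transported by the
  finite energy property (GH: "the infinite component of `I^{+∗}_up ∖ Δ`").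

## References

* H.-O. Georgii, Y. Higuchi, J. Math. Phys. 41 (2000), Lemma 5.2 [GeorgiiHiguchi2000].
-/

noncomputable section

open MeasureTheory SimpleGraph Finset
open Literature.Probability.Percolation
open scoped ENNReal

namespace Literature.Probability.LatticeModels

/-! ### Measurability of the exploration domain -/

section Measurable

variable (m L : ℕ)

/-- `ω ↦ U(ω)` is measurable. [folklore] -/
theorem measurable_pinU : Measurable (pinU m : SpinConfig (Site 2) → Set (Site 2)) := by
  have h := (measurable_spinSites_inter_diff (V := Site 2) 1 (halfPlane 0 \ (↑(box 2 m) ∪ farAxis m)) ∅).mono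
    cylinderEvents_le_pi le_rfl
  have heq : (pinU m : SpinConfig (Site 2) → Set (Site 2)) =
      fun ω => (spinSites 1 ω ∩ (halfPlane 0 \ (↑(box 2 m) ∪ farAxis m))) \ ↑(∅ : Finset (Site 2)) := by
    funext ω; simp [pinU]
  rw [heq]; exact h

/-- `{z ∈ J}` is measurable. [folklore] -/
theorem measurableSet_mem_pinJ (z : Site 2) : MeasurableSet {ω : SpinConfig (Site 2) | z ∈ pinJ m ω} := by
  classical
  exact measurable_pinU m (measurableSet_sitePercolatesAt (G := zdStarGraph) z)

/-- `{z ∈ Ksym}` is measurable. [folklore] -/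
theorem measurableSet_mem_pinKsym (z : Site 2) : MeasurableSet {ω : SpinConfig (Site 2) | z ∈ pinKsym m L ω} := by
  have hK : ∀ z, MeasurableSet {ω : SpinConfig (Site 2) | z ∈ pinK m L ω} := fun z => by
    by_cases hz : z ∈ box 2 L
    · have : {ω : SpinConfig (Site 2) | z ∈ pinK m L ω} = {ω | z ∈ pinJ m ω} := by
        ext ω; simp only [pinK, Set.mem_setOf_eq]; exact ⟨fun h => h.2, fun h => ⟨hz, h⟩⟩
      rw [this]; exact measurableSet_mem_pinJ m z
    · have : {ω : SpinConfig (Site 2) | z ∈ pinK m L ω} = ∅ := by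
        ext ω; simp only [pinK, Set.mem_setOf_eq, Set.mem_empty_iff_false, iff_false]; exact fun h => hz h.1
      rw [this]; exact MeasurableSet.empty
  have : {ω : SpinConfig (Site 2) | z ∈ pinKsym m L ω} = {ω | z ∈ pinK m L ω} ∪ {ω | Rf z ∈ pinK m L ω} := by
    ext ω; simp [pinKsym]
  rw [this]; exact (hK z).union (hK (Rf z))

/-- `{z passable}` is measurable. [folklore] -/
theorem measurableSet_mem_pinPass (z : Site 2) : MeasurableSet {ω : SpinConfig (Site 2) | z ∈ pinPass m L ω} := by
  by_cases hz : z ∈ pinOut L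
  · have : {ω : SpinConfig (Site 2) | z ∈ pinPass m L ω} = Set.univ := by ext ω; simp [pinPass, hz]
    rw [this]; exact MeasurableSet.univ
  · have : {ω : SpinConfig (Site 2) | z ∈ pinPass m L ω} = {ω | z ∈ pinKsym m L ω}ᶜ := by ext ω; simp [pinPass, hz]
    rw [this]; exact (measurableSet_mem_pinKsym m L z).compl

/-- `{z reachable}` is measurable (countable union over reaching walks). [folklore] -/
theorem measurableSet_mem_pinReach (z : Site 2) : MeasurableSet {ω : SpinConfig (Site 2) | z ∈ pinReach m L ω} := by
  have heq : {ω : SpinConfig (Site 2) | z ∈ pinReach m L ω} =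
      ⋃ y : Site 2, ⋃ (_ : y ∈ pinOut L), ⋃ l : List (Site 2), ⋃ (_ : ∃ w : (zdGraph 2).Walk y z, w.support = l),
        ⋂ v ∈ l, {ω : SpinConfig (Site 2) | v ∈ pinPass m L ω} := by
    ext ω
    simp only [pinReach, Set.mem_setOf_eq, Set.mem_iUnion, Set.mem_iInter, exists_prop]
    constructor
    · rintro ⟨y, hy, w, hw⟩; exact ⟨y, hy, w.support, ⟨w, rfl⟩, hw⟩
    · rintro ⟨y, hy, l, ⟨w, rfl⟩, hw⟩; exact ⟨y, hy, w, hw⟩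
  rw [heq]
  exact MeasurableSet.iUnion fun y => MeasurableSet.iUnion fun _ => MeasurableSet.iUnion fun l =>
    MeasurableSet.iUnion fun _ => MeasurableSet.biInter (Set.Finite.countable (List.finite_toSet l)) fun v _ =>
      measurableSet_mem_pinPass m L v

/-- `{k in the crust}` is measurable. [folklore] -/
theorem measurableSet_mem_pinCrust (k : Site 2) : MeasurableSet {ω : SpinConfig (Site 2) | k ∈ pinCrust m L ω} := by
  have heq : {ω : SpinConfig (Site 2) | k ∈ pinCrust m L ω} =
      {ω | k ∈ pinPass m L ω}ᶜ ∩ ⋃ y : Site 2, ⋃ (_ : (zdGraph 2).Adj k y), {ω | y ∈ pinReach m L ω} := by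
    ext ω
    simp only [pinCrust, Set.mem_setOf_eq, Set.mem_inter_iff, Set.mem_compl_iff, Set.mem_iUnion, exists_prop]
    constructor
    · rintro ⟨h1, y, hy, hky⟩; exact ⟨h1, y, hky, hy⟩
    · rintro ⟨h1, y, hky, hy⟩; exact ⟨h1, y, hy, hky⟩
  rw [heq]
  exact (measurableSet_mem_pinPass m L k).compl.inter (MeasurableSet.iUnion fun y => MeasurableSet.iUnion fun _ =>
    measurableSet_mem_pinReach m L y)

/-- `{z in the domain}` is measurable. [folklore] -/
theorem measurableSet_mem_pinDom (z : Site 2) : MeasurableSet {ω : SpinConfig (Site 2) | z ∈ pinDom m L ω} := by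
  have : {ω : SpinConfig (Site 2) | z ∈ pinDom m L ω} = {ω | z ∈ pinReach m L ω}ᶜ ∩ {ω | z ∈ pinCrust m L ω}ᶜ := by
    ext ω; simp only [Set.mem_setOf_eq, mem_pinDom_iff, Set.mem_inter_iff, Set.mem_compl_iff]
  rw [this]; exact (measurableSet_mem_pinReach m L z).compl.inter (measurableSet_mem_pinCrust m L z).compl

/-- **`{pinDom = G}` is measurable.** [folklore] -/
theorem measurableSet_pinDom_eq (G : Finset (Site 2)) : MeasurableSet {ω : SpinConfig (Site 2) | pinDom m L ω = G} := by
  have heq : {ω : SpinConfig (Site 2) | pinDom m L ω = G} =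
      ⋂ z : Site 2, {ω | z ∈ pinDom m L ω ↔ z ∈ G} := by
    ext ω; simp only [Set.mem_setOf_eq, Set.mem_iInter, Finset.ext_iff]
  rw [heq]
  refine MeasurableSet.iInter fun z => ?_
  by_cases hz : z ∈ G
  · have : {ω : SpinConfig (Site 2) | z ∈ pinDom m L ω ↔ z ∈ G} = {ω | z ∈ pinDom m L ω} := by ext ω; simp [hz]
    rw [this]; exact measurableSet_mem_pinDom m L z
  · have : {ω : SpinConfig (Site 2) | z ∈ pinDom m L ω ↔ z ∈ G} = {ω | z ∈ pinDom m L ω}ᶜ := by ext ω; simp [hz]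
    rw [this]; exact (measurableSet_mem_pinDom m L z).compl

end Measurable

/-! ### The strong-Markov hypothesis -/

/-- **A measurable event invariant under re-patching the spins in a finite `G` belongs to
`𝓕_{Gᶜ}`.** [folklore] -/
theorem measurableSet_cylinderEvents_compl_of_invariant {V : Type*} (G : Finset V) {A : Set (SpinConfig V)}
    (hA : MeasurableSet A) (hinv : ∀ (ω : SpinConfig V) (τ : G → ℤˣ), glueWith G τ ω ∈ A ↔ ω ∈ A) :
    MeasurableSet[cylinderEvents (X := fun _ : V => ℤˣ) ((↑G : Set V)ᶜ)] A := by
  classical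
  set g : SpinConfig V → SpinConfig V := fun ω => glueWith G (fun _ => 1) ω with hg
  have hgm : Measurable[cylinderEvents (X := fun _ : V => ℤˣ) ((↑G : Set V)ᶜ), MeasurableSpace.pi] g := by
    refine @measurable_pi_lambda _ _ _ (cylinderEvents (X := fun _ : V => ℤˣ) ((↑G : Set V)ᶜ)) _ g fun x => ?_
    by_cases hx : x ∈ G
    · simp only [hg, glueWith_apply_mem _ _ _ hx]; exact measurable_const
    · simp only [hg, glueWith_apply_not_mem _ _ _ hx]
      exact measurable_cylinderEvent_apply (X := fun _ : V => ℤˣ) (show x ∈ ((↑G : Set V)ᶜ) from fun h => hx (Finset.mem_coe.1 h))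
  have heq : A = g ⁻¹' A := by
    ext ω; simp only [Set.mem_preimage, hg, hinv ω]
  rw [heq]
  exact hgm hA

/-- **`{pinDom = G} ∈ 𝓕_{Gᶜ}`**: the exploration domain is determined from outside
(`pinDom_eq_of_agree`) — the measurability hypothesis of the strong Markov property. [cite: GeorgiiHiguchi2000, Lemma 5.2 (proof: strong Markov property)] -/
theorem measurableSet_cylinderEvents_pinDom_eq (m L : ℕ) (G : Finset (Site 2)) :
    MeasurableSet[cylinderEvents (X := fun _ : Site 2 => ℤˣ) ((↑G : Set (Site 2))ᶜ)] {ω : SpinConfig (Site 2) | pinDom m L ω = G} := by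
  refine measurableSet_cylinderEvents_compl_of_invariant G (measurableSet_pinDom_eq m L G) fun ω τ => ?_
  simp only [Set.mem_setOf_eq]
  constructor <;> intro h
  · -- `ω` agrees with the patched configuration off `G = pinDom (patched)`
    have key := pinDom_eq_of_agree (m := m) (L := L) (ω := glueWith G τ ω) (ω' := ω) fun v hv => by
      rw [h] at hv; exact (glueWith_apply_not_mem _ _ _ hv).symm
    rw [key, h]
  · have key := pinDom_eq_of_agree (m := m) (L := L) (ω := ω) (ω' := glueWith G τ ω) fun v hv => by
      rw [h] at hv; exact glueWith_apply_not_mem _ _ _ hv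
    rw [key, h]

/-! ### Almost surely `J` is `∗`-connected -/

section Connected

variable {β : ℝ} {μ : Measure (SpinConfig (Site 2))}

/-- The `+`sites of `π_up ∖ Λ_m` are the `+`half-plane sites of the configuration patched to `-1` on
`Λ_m`. [folklore] -/
theorem spinSites_inter_halfPlane_diff_box_eq_glueWith (m : ℕ) (ω : SpinConfig (Site 2)) :
    spinSites 1 ω ∩ (halfPlane 0 \ ↑(box 2 m)) = spinSites 1 (glueWith (box 2 m) (fun _ => -1) ω) ∩ halfPlane 0 := by
  ext z
  simp only [Set.mem_inter_iff, mem_spinSites, Set.mem_sdiff, Finset.mem_coe]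
  by_cases hz : z ∈ box 2 m
  · simp [hz]
  · simp [hz]

/-- **Almost surely the infinite `+∗`cluster of `S⁺ ∩ (π_up ∖ Λ_m)` is unique** (`β > β_c(2)`,
`μ ∈ 𝒢(β, 0)`): uniqueness in the half-plane for the configuration patched to `-1` on `Λ_m`, and
finite energy. [cite: GeorgiiHiguchi2000, Lemma 5.2 (proof: "the infinite component of `I^{+∗}_up ∖ Δ`")] -/
theorem ae_starCluster_unique_halfPlane_diff_box (hβc : criticalBeta 2 < β) (hμ : μ ∈ isingGibbsMeasures 2 β 0) (m : ℕ) :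
    ∀ᵐ ω ∂μ, ∀ x₁ x₂, (siteCluster zdStarGraph (spinSites 1 ω ∩ (halfPlane 0 \ ↑(box 2 m))) x₁).Infinite →
      (siteCluster zdStarGraph (spinSites 1 ω ∩ (halfPlane 0 \ ↑(box 2 m))) x₂).Infinite →
      x₂ ∈ siteCluster zdStarGraph (spinSites 1 ω ∩ (halfPlane 0 \ ↑(box 2 m))) x₁ := by
  classical
  have hμG : IsGibbsMeasure (isingSpecification (zdGraph 2) β 0) μ := hμ
  haveI := hμG.isProbabilityMeasure
  -- the uniqueness event for the half-plane `+`set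
  set V : Set (SpinConfig (Site 2)) := {σ | ∀ x₁ x₂, (siteCluster zdStarGraph (spinSites 1 σ ∩ halfPlane 0) x₁).Infinite →
    (siteCluster zdStarGraph (spinSites 1 σ ∩ halfPlane 0) x₂).Infinite →
    x₂ ∈ siteCluster zdStarGraph (spinSites 1 σ ∩ halfPlane 0) x₁} with hV
  have hVm : MeasurableSet V := by
    have hmeas : Measurable fun σ : SpinConfig (Site 2) => spinSites 1 σ ∩ halfPlane 0 := by
      have h := (measurable_spinSites_inter_diff (V := Site 2) 1 (halfPlane 0) ∅).mono cylinderEvents_le_pi le_rfl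
      simpa using h
    have : V = ⋂ x₁ : Site 2, ⋂ x₂ : Site 2, ((fun σ => spinSites 1 σ ∩ halfPlane 0) ⁻¹' sitePercolatesAt zdStarGraph x₁)ᶜ ∪
        (((fun σ => spinSites 1 σ ∩ halfPlane 0) ⁻¹' sitePercolatesAt zdStarGraph x₂)ᶜ ∪
        ((fun σ => spinSites 1 σ ∩ halfPlane 0) ⁻¹' {O | x₂ ∈ siteCluster zdStarGraph O x₁})) := by
      ext σ
      simp only [hV, Set.mem_setOf_eq, Set.mem_iInter, Set.mem_union, Set.mem_compl_iff, Set.mem_preimage, sitePercolatesAt]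
      refine forall_congr' fun x₁ => forall_congr' fun x₂ => ?_
      tauto
    rw [this]
    exact MeasurableSet.iInter fun x₁ => MeasurableSet.iInter fun x₂ =>
      (hmeas (measurableSet_sitePercolatesAt (G := zdStarGraph) x₁)).compl.union
        ((hmeas (measurableSet_sitePercolatesAt (G := zdStarGraph) x₂)).compl.union
          (hmeas (measurableSet_mem_siteCluster (G := zdStarGraph) x₁ x₂)))
  have hV1 : μ Vᶜ = 0 := by
    have h := ae_starCluster_unique_halfPlane hβc hμ 1
    rw [ae_iff] at h
    refine measure_mono_null (fun σ hσ => ?_) h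
    simp only [Set.mem_compl_iff, hV, Set.mem_setOf_eq, not_forall] at hσ ⊢
    obtain ⟨x₁, x₂, h₁, h₂, hne⟩ := hσ
    refine ⟨x₁, x₂, h₁, h₂, fun heq => hne ?_⟩
    rw [heq]
    obtain ⟨z, hz⟩ := h₂.nonempty
    exact (mem_siteCluster_self_iff _ _ _).2 hz.1
  -- finite energy transports the null set to the patched configuration
  have hpre : μ {η | glueWith (box 2 m) (fun _ => (-1 : ℤˣ)) η ∈ Vᶜ} = 0 := by
    have h := hμG.mul_measure_glueWith_preimage_le (G := zdGraph 2) (box 2 m) (fun _ => -1) hVm.compl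
    rw [hV1, nonpos_iff_eq_zero, mul_eq_zero] at h
    rcases h with h | h
    · exfalso
      exact (ENNReal.ofReal_pos.2 (by positivity)).ne' h
    · exact h
  rw [ae_iff]
  refine measure_mono_null (fun ω hω => ?_) hpre
  simp only [Set.mem_setOf_eq, not_forall, Set.mem_compl_iff, hV] at hω ⊢
  obtain ⟨x₁, x₂, h₁, h₂, hno⟩ := hω
  refine ⟨x₁, x₂, ?_, ?_, ?_⟩ <;> rw [← spinSites_inter_halfPlane_diff_box_eq_glueWith]
  · exact h₁
  · exact h₂
  · exact hno

end Connected

end Literature.Probability.LatticeModels
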